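import Mathlib
import HarnessLib
import Summits.HubbardSuperconductivity.HubbardSuperconductivity.Theorems.KLProgrammeKLRegimeEnginePairTransferRelResStep
import Summits.HubbardSuperconductivity.HubbardSuperconductivity.Theorems.KLProgrammeKLRegimeEnginePairTransferK5Step

/-!
# Route `KLProgramme` — ENGINE child gen 8 (stmt-HubbardSuperconductivity-20437 `KLRegimeEngineV17F2`), skeleton v2 class #5 rev 3 (INDEX form, Export5): the RELATIVE-RESIDUE
# organisation in INDEX form — `pairTransferRelResIdx_family_succ` (the private Ẽ-family `n → n+1`) and `pairTransferRelFamilyK5_of_relResIdx` (EXPORT of the private family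
# to Export5's `PairTransferRelFamilyK5`) (cell gate-hubbard-kl, seat hubbard-kl-k3c1-p1 g11, technique «composed-map remainder propagation»; located item #19 «(c)-DRESSING-AVG»)

WHY.  With `pairTransferRelRes_succ_keyed` (p594243) and `pairTransferStep5_of_private` (p594470) the producer can run the class-#5 induction on the PRIVATE family
«`‖Ẽ_n(s_{n,j} | s_{n,j′})(k,k′)‖ ≤ RB n j j′ Qm k k′` on the bare ball, `n ≤ j′ ≤ j ≤ n_β+1`» (bars `RB` of its choice) and export Export5's family once per scale.  This file is
the INDEX plumbing of that organisation, symmetric to `pairTransferRelIdx_family_succ` (p592121):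
* **`pairTransferRelResIdx_family_succ`** — private family at `n` ⟹ private family at `n+1`, from `Z^{K_{n+1}} ≠ 0` on the slice and per pair / pair class the SIZES bundle of
  `pairTransferRelRes_succ_keyed` on ONE family of member curves indexed by the member index (nine lambdas, pass `rfl`×5);
* **`pairTransferRelFamilyK5_of_relResIdx`** — private family at `n` + per pair / class the EXPORT data (a priori `|A°_n[s_{n,j′}]| ≤ mA`, `mA·Σ|t_n[s_j] − t_n[s_j′]| ≤ 1/3`,
  `RB n j j′ + Σ_c RB(k,c)|…|_c(3mA/2) ≤ transferBarRelIdx … n j′` on the ball — the ONE windowed-mass convolution per scale, (W2-a)) ⟹ `PairTransferRelFamilyK5 … n`.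
Plumbing over landed doors; nothing about the model's sizes is asserted; nothing asserts superconductivity.  0 kit.
-/

noncomputable section

namespace Summit.HubbardSuperconductivity.HubbardSuperconductivity.Theorems.KLRegimeSplit

set_option linter.dupNamespace false -- summit = problem name (single-conjunct summit), D-0017

open Finset Matrix Set Literature.MathematicalPhysics.QuantumLattice Literature.Probability.LatticeModels GrassmannAlgebra
open Literature.MathematicalPhysics.QuantumLattice.FermiRG
open Summit.HubbardSuperconductivity.HubbardSuperconductivity.Theorems.KLProgrammeCooperResummation
open Summit.HubbardSuperconductivity.HubbardSuperconductivity.Theorems.KLProgrammeLegKernels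
open Summit.HubbardSuperconductivity.HubbardSuperconductivity.Theorems.DispersionFlow
open Summit.HubbardSuperconductivity.HubbardSuperconductivity.Theorems.KLRegimeWick
open Summit.HubbardSuperconductivity.HubbardSuperconductivity.Theorems.EngineV8

section Family

variable (L M : ℕ) [NeZero L] [NeZero M]

set_option maxHeartbeats 1600000 in -- very long hypothesis bundle; plumbing into `pairTransferRelRes_succ_keyed`
/-- **`pairTransferRelResIdx_family_succ`** — the private relative-residue family of the cutoff-built pairs, `n → n+1` (see the module docstring). -/
theorem pairTransferRelResIdx_family_succ {β U μ : ℝ} {n : ℕ} {mA : ℝ} (hm : 0 ≤ mA)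
    {RB : ℕ → ℕ → ℕ → TorusSite 2 L → TorusSite 2 L → TorusSite 2 L → ℝ}
    (hZ : ∀ Λ ∈ Icc (klScale klE0 (n + 1)) (klScale klE0 n), hubbardEffPartitionFnCT L M β U μ 0 (klFlowFrameU L M β U μ (n + 1)) Λ ≠ 0)
    (A A' : ℕ → TorusSite 2 L → ℝ → Matrix (TorusSite 2 L) (TorusSite 2 L) ℂ) (b b' : ℕ → TorusSite 2 L → ℝ → TorusSite 2 L → ℂ)
    (a : ℕ → ℕ → TorusSite 2 L → ℝ → TorusSite 2 L → ℂ)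
    (hAdef : A = fun j Qm t => Matrix.of fun k k' : TorusSite 2 L => if k ∈ klBall L μ 0 ∧ k' ∈ klBall L μ 0 then
      vertexFn L M β (gaussConv ℂ
        (softCovOf L M β μ (klFlowFrameU L M β U μ (n + 1)) (softSymbolCompl L M β μ (klFlowFrameU L M β U μ (n + 1)) (n + 1) j) + hubbardCovAboveCT L M β μ 0 (klFlowFrameU L M β U μ (n + 1)) (klScale klE0 (n + 1)) -
          hubbardCovAboveCT L M β μ 0 (klFlowFrameU L M β U μ (n + 1)) (klScale klE0 n + t * (klScale klE0 (n + 1) - klScale klE0 n)))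
        (hubbardEffectiveActionCT L M β U μ 0 (klFlowFrameU L M β U μ (n + 1)) (klScale klE0 n + t * (klScale klE0 (n + 1) - klScale klE0 n)))) 4
        ![(((omega0 M, k'), 0), 0), ((((omega0 M).rev, Qm - k'), 1), 0), ((((omega0 M).rev, Qm - k), 1), 1), (((omega0 M, k), 0), 1)]
      else 0)
    (hA'def : A' = fun j Qm t => Matrix.of fun k k' : TorusSite 2 L => if k ∈ klBall L μ 0 ∧ k' ∈ klBall L μ 0 then
      (klScale klE0 (n + 1) - klScale klE0 n) • -((2 : ℂ)⁻¹ * vertexFn L M β (gaussConv ℂ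
        (softCovOf L M β μ (klFlowFrameU L M β U μ (n + 1)) (softSymbolCompl L M β μ (klFlowFrameU L M β U μ (n + 1)) (n + 1) j) + hubbardCovAboveCT L M β μ 0 (klFlowFrameU L M β U μ (n + 1)) (klScale klE0 (n + 1)) -
          hubbardCovAboveCT L M β μ 0 (klFlowFrameU L M β U μ (n + 1)) (klScale klE0 n + t * (klScale klE0 (n + 1) - klScale klE0 n)))
        (grassmannDerivPairing ℂ
          (Matrix.of fun X Y : HubbardFieldIdx L M => deriv (fun Λ'' : ℝ => hubbardCovAboveCT L M β μ 0 (klFlowFrameU L M β U μ (n + 1)) Λ'' X Y)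
            (klScale klE0 n + t * (klScale klE0 (n + 1) - klScale klE0 n)))
          (hubbardEffectiveActionCT L M β U μ 0 (klFlowFrameU L M β U μ (n + 1)) (klScale klE0 n + t * (klScale klE0 (n + 1) - klScale klE0 n)))
          (hubbardEffectiveActionCT L M β U μ 0 (klFlowFrameU L M β U μ (n + 1)) (klScale klE0 n + t * (klScale klE0 (n + 1) - klScale klE0 n))))) 4
        ![(((omega0 M, k'), 0), 0), ((((omega0 M).rev, Qm - k'), 1), 0), ((((omega0 M).rev, Qm - k), 1), 1), (((omega0 M, k), 0), 1)])
      else 0)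
    (hbdef : b = fun j Qm t p => -((klBubbleMass L M β μ (klFlowFrameU L M β U μ (n + 1))
        (fun k => (softSymbolCompl L M β μ (klFlowFrameU L M β U μ (n + 1)) (n + 1) j) k + (hubbardCutoffWeightCT L M β μ (klFlowFrameU L M β U μ (n + 1)) (klScale klE0 (n + 1)) k -
          hubbardCutoffWeightCT L M β μ (klFlowFrameU L M β U μ (n + 1)) (klScale klE0 n + t * (klScale klE0 (n + 1) - klScale klE0 n)) k))
        (fun k => (softSymbolCompl L M β μ (klFlowFrameU L M β U μ (n + 1)) (n + 1) j) k + (hubbardCutoffWeightCT L M β μ (klFlowFrameU L M β U μ (n + 1)) (klScale klE0 (n + 1)) k -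
          hubbardCutoffWeightCT L M β μ (klFlowFrameU L M β U μ (n + 1)) (klScale klE0 n + t * (klScale klE0 (n + 1) - klScale klE0 n)) k)) Qm p : ℝ) : ℂ))
    (hb'def : b' = fun j Qm t p => (((klScale klE0 (n + 1) - klScale klE0 n) *
        (klBubbleMass L M β μ (klFlowFrameU L M β U μ (n + 1))
            (fun k => deriv (fun Λ' => hubbardCutoffWeightCT L M β μ (klFlowFrameU L M β U μ (n + 1)) Λ' k) (klScale klE0 n + t * (klScale klE0 (n + 1) - klScale klE0 n)))
            (fun k => (softSymbolCompl L M β μ (klFlowFrameU L M β U μ (n + 1)) (n + 1) j) k + (hubbardCutoffWeightCT L M β μ (klFlowFrameU L M β U μ (n + 1)) (klScale klE0 (n + 1)) k -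
          hubbardCutoffWeightCT L M β μ (klFlowFrameU L M β U μ (n + 1)) (klScale klE0 n + t * (klScale klE0 (n + 1) - klScale klE0 n)) k)) Qm p +
          klBubbleMass L M β μ (klFlowFrameU L M β U μ (n + 1))
            (fun k => (softSymbolCompl L M β μ (klFlowFrameU L M β U μ (n + 1)) (n + 1) j) k + (hubbardCutoffWeightCT L M β μ (klFlowFrameU L M β U μ (n + 1)) (klScale klE0 (n + 1)) k -
          hubbardCutoffWeightCT L M β μ (klFlowFrameU L M β U μ (n + 1)) (klScale klE0 n + t * (klScale klE0 (n + 1) - klScale klE0 n)) k))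
            (fun k => deriv (fun Λ' => hubbardCutoffWeightCT L M β μ (klFlowFrameU L M β U μ (n + 1)) Λ' k) (klScale klE0 n + t * (klScale klE0 (n + 1) - klScale klE0 n)))
            Qm p) : ℝ) : ℂ))
    (hadef : a = fun j j' Qm t p => (b j Qm t p - b j' Qm t p) +
      (-(((klTransferWeight L M β μ (klFlowFrameU L M β U μ (n + 1)) (n + 1) (softSymbolCompl L M β μ (klFlowFrameU L M β U μ (n + 1)) (n + 1) j) Qm p -
          klTransferWeight L M β μ (klFlowFrameU L M β U μ (n + 1)) (n + 1) (softSymbolCompl L M β μ (klFlowFrameU L M β U μ (n + 1)) (n + 1) j') Qm p : ℝ)) : ℂ) -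
        (b j Qm 1 p - b j' Qm 1 p)))
    (hhist : ∀ j j' : ℕ, n ≤ j' → j' ≤ j → j ≤ nScales β + 1 → ∀ Qm : TorusSite 2 L, IsPairClassAt L Qm n →
      ∀ k ∈ klBall L μ 0, ∀ k' ∈ klBall L μ 0,
      ‖(klMemberArrayF L M β U μ n (softSymbolCompl L M β μ (klFlowFrameU L M β U μ n) n j) Qm + klMemberArrayF L M β U μ n (softSymbolCompl L M β μ (klFlowFrameU L M β U μ n) n j) Qm *
          diagonal (fun c => -(((klTransferWeight L M β μ (klFlowFrameU L M β U μ n) n (softSymbolCompl L M β μ (klFlowFrameU L M β U μ n) n j) Qm c -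
            klTransferWeight L M β μ (klFlowFrameU L M β U μ n) n (softSymbolCompl L M β μ (klFlowFrameU L M β U μ n) n j') Qm c : ℝ)) : ℂ)) * klMemberArrayF L M β U μ n (softSymbolCompl L M β μ (klFlowFrameU L M β U μ n) n j') Qm -
          klMemberArrayF L M β U μ n (softSymbolCompl L M β μ (klFlowFrameU L M β U μ n) n j') Qm) k k'‖ ≤ RB n j j' Qm k k')
    (hdata : ∀ j j' : ℕ, n + 1 ≤ j' → j' ≤ j → j ≤ nScales β + 1 → ∀ Qm : TorusSite 2 L, IsPairClassAt L Qm (n + 1) →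
      ∃ (ρ₁ ρ₂ : TorusSite 2 L → ℝ) (ηr η₁ η₂ T₀ I S : TorusSite 2 L → TorusSite 2 L → ℝ) (d : TorusSite 2 L → ℝ) (β' δ ξ ξ₁ ξ₂ : ℝ),
        0 ≤ ξ ∧ 0 ≤ ξ₁ ∧ 0 ≤ ξ₂ ∧
        -- a priori sizes of the two member arrays, rates, profiles, smallness, Riccati-defect sups
        (∀ t ∈ Icc (0 : ℝ) 1, ∀ x y, ‖A j Qm t x y‖ ≤ mA) ∧ (∀ t ∈ Icc (0 : ℝ) 1, ∀ x y, ‖A j' Qm t x y‖ ≤ mA) ∧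
        (∀ t ∈ Icc (0 : ℝ) 1, ∑ c, ‖b' j Qm t c‖ ≤ β') ∧ (∀ t ∈ Icc (0 : ℝ) 1, ∑ c, ‖b' j' Qm t c‖ ≤ β') ∧
        (∀ t ∈ Icc (0 : ℝ) 1, ∀ c, ‖b j Qm t c - b j Qm 0 c‖ ≤ ρ₁ c) ∧ (∀ t ∈ Icc (0 : ℝ) 1, ∀ c, ‖b j' Qm t c - b j' Qm 0 c‖ ≤ ρ₂ c) ∧
        mA * β' ≤ 1 / 3 ∧ mA * ∑ c, ρ₁ c ≤ 1 / 3 ∧ mA * ∑ c, ρ₂ c ≤ 1 / 3 ∧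
        (∀ t ∈ Icc (0 : ℝ) 1, ∀ x y, ‖(A' j Qm t + A j Qm t * diagonal (b' j Qm t) * A j Qm t) x y‖ ≤ ξ₁) ∧
        (∀ t ∈ Icc (0 : ℝ) 1, ∀ x y, ‖(A' j' Qm t + A j' Qm t * diagonal (b' j' Qm t) * A j' Qm t) x y‖ ≤ ξ₂) ∧
        -- the history arrays' a priori size and the START RE-FRAME majorants ((F)(i) lane) against the history objects at frame `K_n`
        (∀ x y, ‖klMemberArrayF L M β U μ n (softSymbolCompl L M β μ (klFlowFrameU L M β U μ n) n j) Qm x y‖ ≤ mA) ∧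
        (∀ x y, ‖((A j Qm 0 - klMemberArrayF L M β U μ n (softSymbolCompl L M β μ (klFlowFrameU L M β U μ n) n j) Qm) - (A j' Qm 0 - klMemberArrayF L M β U μ n (softSymbolCompl L M β μ (klFlowFrameU L M β U μ n) n j') Qm)) x y‖ ≤ ηr x y) ∧
        (∀ x y, ‖(A j Qm 0 - klMemberArrayF L M β U μ n (softSymbolCompl L M β μ (klFlowFrameU L M β U μ n) n j) Qm) x y‖ ≤ η₁ x y) ∧
        (∀ x y, ‖(A j' Qm 0 - klMemberArrayF L M β U μ n (softSymbolCompl L M β μ (klFlowFrameU L M β U μ n) n j') Qm) x y‖ ≤ η₂ x y) ∧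
        (∀ c, ‖a j j' Qm 0 c - -(((klTransferWeight L M β μ (klFlowFrameU L M β U μ n) n (softSymbolCompl L M β μ (klFlowFrameU L M β U μ n) n j) Qm c -
            klTransferWeight L M β μ (klFlowFrameU L M β U μ n) n (softSymbolCompl L M β μ (klFlowFrameU L M β U μ n) n j') Qm c : ℝ)) : ℂ)‖ ≤ d c) ∧
        -- the start residue majorant (history bar + re-frame terms; NO convolution of the bar), its sup, the source lines, the four-term input majorant
        (∀ x y, (if x ∈ klBall L μ 0 ∧ y ∈ klBall L μ 0 then RB n j j' Qm x y else 0) +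
            ηr x y + mA * ∑ c, η₁ x c * ‖a j j' Qm 0 c‖ + mA * mA * ∑ c, d c +
            mA * ∑ c, ‖(-(((klTransferWeight L M β μ (klFlowFrameU L M β U μ n) n (softSymbolCompl L M β μ (klFlowFrameU L M β U μ n) n j) Qm c -
            klTransferWeight L M β μ (klFlowFrameU L M β U μ n) n (softSymbolCompl L M β μ (klFlowFrameU L M β U μ n) n j') Qm c : ℝ)) : ℂ))‖ * η₂ c y ≤ T₀ x y) ∧
        (∀ x y, T₀ x y ≤ δ) ∧
        (∀ t ∈ Icc (0 : ℝ) 1, ∀ x y, ‖((A' j Qm t + A j Qm t * diagonal (b' j Qm t) * A j Qm t) * (1 + diagonal (a j j' Qm t) * A j' Qm t) +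
            A j Qm t * diagonal (a j j' Qm t) * (A' j' Qm t + A j' Qm t * diagonal (b' j' Qm t) * A j' Qm t) - (A' j' Qm t + A j' Qm t * diagonal (b' j' Qm t) * A j' Qm t)) x y‖ ≤ ξ) ∧
        (∀ x y, (∫ t in (0 : ℝ)..1, ‖((A' j Qm t + A j Qm t * diagonal (b' j Qm t) * A j Qm t) * (1 + diagonal (a j j' Qm t) * A j' Qm t) +
            A j Qm t * diagonal (a j j' Qm t) * (A' j' Qm t + A j' Qm t * diagonal (b' j' Qm t) * A j' Qm t) - (A' j' Qm t + A j' Qm t * diagonal (b' j' Qm t) * A j' Qm t)) x y‖) ≤ I x y) ∧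
        (∀ x y, T₀ x y +
            (I x y + ∑ c, I x c * ρ₂ c * mA + ∑ a', mA * ρ₁ a' * I a' y + ∑ a', ∑ c, mA * ρ₁ a' * I a' c * ρ₂ c * mA) +
            4 / 3 * (δ * Real.exp (mA * β' + mA * β') + 2 * ξ) * β' * (8 / 3 * ξ₁ + 8 / 3 * ξ₂) ≤ S x y) ∧
        -- the private bar at `n+1` dominates the four-term form of `S` on the bare ball
        (∀ k ∈ klBall L μ 0, ∀ k' ∈ klBall L μ 0, S k k' + ∑ c, S k c * ρ₂ c * (3 / 2 * mA) + ∑ a', 3 / 2 * mA * ρ₁ a' * S a' k' +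
          ∑ a', ∑ c, 3 / 2 * mA * ρ₁ a' * S a' c * ρ₂ c * (3 / 2 * mA) ≤ RB (n + 1) j j' Qm k k')) :
    ∀ j j' : ℕ, n + 1 ≤ j' → j' ≤ j → j ≤ nScales β + 1 → ∀ Qm : TorusSite 2 L, IsPairClassAt L Qm (n + 1) →
      ∀ k ∈ klBall L μ 0, ∀ k' ∈ klBall L μ 0,
      ‖(klMemberArrayF L M β U μ (n + 1) (softSymbolCompl L M β μ (klFlowFrameU L M β U μ (n + 1)) (n + 1) j) Qm + klMemberArrayF L M β U μ (n + 1) (softSymbolCompl L M β μ (klFlowFrameU L M β U μ (n + 1)) (n + 1) j) Qm *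
          diagonal (fun p => -(((klTransferWeight L M β μ (klFlowFrameU L M β U μ (n + 1)) (n + 1) (softSymbolCompl L M β μ (klFlowFrameU L M β U μ (n + 1)) (n + 1) j) Qm p -
            klTransferWeight L M β μ (klFlowFrameU L M β U μ (n + 1)) (n + 1) (softSymbolCompl L M β μ (klFlowFrameU L M β U μ (n + 1)) (n + 1) j') Qm p : ℝ)) : ℂ)) * klMemberArrayF L M β U μ (n + 1) (softSymbolCompl L M β μ (klFlowFrameU L M β U μ (n + 1)) (n + 1) j') Qm -
          klMemberArrayF L M β U μ (n + 1) (softSymbolCompl L M β μ (klFlowFrameU L M β U μ (n + 1)) (n + 1) j') Qm) k k'‖ ≤ RB (n + 1) j j' Qm k k' := by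
  subst hAdef hA'def hbdef hb'def hadef
  intro j j' h1 h2 h3
  exact pairTransferRelRes_succ_keyed L M hm (fun Qm hQm => hhist j j' ((Nat.le_succ n).trans h1) h2 h3 Qm hQm) hZ _ _ _ _ _ _ _ _ _
    rfl rfl rfl rfl rfl rfl rfl rfl rfl (hdata j j' h1 h2 h3)

/-- **`pairTransferRelFamilyK5_of_relResIdx`** — EXPORT of the private family at scale `n` to Export5's `PairTransferRelFamilyK5 … n` (one conversion per pair class). -/
theorem pairTransferRelFamilyK5_of_relResIdx {G : GeoConsts} {P : SplitConsts} {r β U μ : ℝ} {n : ℕ} {mA : ℝ} (hm : 0 ≤ mA)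
    {RB : ℕ → ℕ → ℕ → TorusSite 2 L → TorusSite 2 L → TorusSite 2 L → ℝ}
    (hhist : ∀ j j' : ℕ, n ≤ j' → j' ≤ j → j ≤ nScales β + 1 → ∀ Qm : TorusSite 2 L, IsPairClassAt L Qm n →
      ∀ k ∈ klBall L μ 0, ∀ k' ∈ klBall L μ 0,
      ‖(klMemberArrayF L M β U μ n (softSymbolCompl L M β μ (klFlowFrameU L M β U μ n) n j) Qm + klMemberArrayF L M β U μ n (softSymbolCompl L M β μ (klFlowFrameU L M β U μ n) n j) Qm *
          diagonal (fun c => -(((klTransferWeight L M β μ (klFlowFrameU L M β U μ n) n (softSymbolCompl L M β μ (klFlowFrameU L M β U μ n) n j) Qm c -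
            klTransferWeight L M β μ (klFlowFrameU L M β U μ n) n (softSymbolCompl L M β μ (klFlowFrameU L M β U μ n) n j') Qm c : ℝ)) : ℂ)) * klMemberArrayF L M β U μ n (softSymbolCompl L M β μ (klFlowFrameU L M β U μ n) n j') Qm -
          klMemberArrayF L M β U μ n (softSymbolCompl L M β μ (klFlowFrameU L M β U μ n) n j') Qm) k k'‖ ≤ RB n j j' Qm k k')
    (hexp : ∀ j j' : ℕ, n ≤ j' → j' ≤ j → j ≤ nScales β + 1 → ∀ Qm : TorusSite 2 L, IsPairClassAt L Qm n →
      (∀ x y, ‖klMemberArrayF L M β U μ n (softSymbolCompl L M β μ (klFlowFrameU L M β U μ n) n j') Qm x y‖ ≤ mA) ∧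
      mA * ∑ c, ‖(-(((klTransferWeight L M β μ (klFlowFrameU L M β U μ n) n (softSymbolCompl L M β μ (klFlowFrameU L M β U μ n) n j) Qm c -
          klTransferWeight L M β μ (klFlowFrameU L M β U μ n) n (softSymbolCompl L M β μ (klFlowFrameU L M β U μ n) n j') Qm c : ℝ)) : ℂ))‖ ≤ 1 / 3 ∧
      (∀ k ∈ klBall L μ 0, ∀ k' ∈ klBall L μ 0, RB n j j' Qm k k' + ∑ c, (if k ∈ klBall L μ 0 ∧ c ∈ klBall L μ 0 then RB n j j' Qm k c else 0) *
          ‖(-(((klTransferWeight L M β μ (klFlowFrameU L M β U μ n) n (softSymbolCompl L M β μ (klFlowFrameU L M β U μ n) n j) Qm c -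
            klTransferWeight L M β μ (klFlowFrameU L M β U μ n) n (softSymbolCompl L M β μ (klFlowFrameU L M β U μ n) n j') Qm c : ℝ)) : ℂ))‖ * (3 / 2 * mA) ≤
          transferBarRelIdx L G P r β U n j' Qm k k')) :
    PairTransferRelFamilyK5 L M G P r β U μ n := by
  intro j j' h1 h2 h3
  refine pairTransferRelAt_of_relResidue (m := mA) hm fun Qm hQm => ?_
  obtain ⟨hA, hsm, hbud⟩ := hexp j j' h1 h2 h3 Qm hQm
  refine ⟨fun x y => if x ∈ klBall L μ 0 ∧ y ∈ klBall L μ 0 then RB n j j' Qm x y else 0, hA, hsm, fun x y => ?_, fun k hk k' hk' => ?_⟩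
  · dsimp only
    by_cases hxy : x ∈ klBall L μ 0 ∧ y ∈ klBall L μ 0
    · rw [if_pos hxy]; exact hhist j j' h1 h2 h3 Qm hQm x hxy.1 y hxy.2
    · rw [if_neg hxy, kltc_relResidue_eq_zero_off _ _ _ (klBall L μ 0) (fun x y h => klMemberArrayF_eq_zero_off β U μ n _ Qm h)
        (fun x y h => klMemberArrayF_eq_zero_off β U μ n _ Qm h) hxy, norm_zero]
  · have hkk : k ∈ klBall L μ 0 ∧ k' ∈ klBall L μ 0 := ⟨hk, hk'⟩
    dsimp only
    rw [if_pos hkk]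
    exact hbud k hk k' hk'

end Family

end Summit.HubbardSuperconductivity.HubbardSuperconductivity.Theorems.KLRegimeSplit

end
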